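import Literature.AlgebraicGeometry.Motives.HodgeTensorConcatenation
import Literature.AlgebraicGeometry.Motives.MumfordTateLieAlgebraSimilitude
import Literature.AlgebraicGeometry.Motives.HodgeLieDirectSum
import Literature.AlgebraicGeometry.Motives.HodgeLieRankLowerBound
import Literature.AlgebraicGeometry.Motives.GenericMumfordTateTypeStability
import Literature.AlgebraicGeometry.Motives.MumfordTateInvariantsTensorFormBasis
import HarnessLib

/-!
# `𝔪𝔱(H) = 𝔥(H) ⊕ ℚ·id` for a polarizable Hodge structure of nonzero weight: `dim MT(H) = dim Hg(H) + 1`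

Family `hodge`, layer `Literature/AlgebraicGeometry/Motives`.  Theorems only; no definition, no named fact.  Written for the
cell `pub-hodgecm2` (COR-CM), seat `b27` gen 35 (count-neutral; stage γ of `HOME/pub-hodgecm2-b27/MT-EQ-HG-PLAN.md`).

For a pure `ℚ`-Hodge structure `H` of weight `n` on a finite-dimensional `V`, the tree defines the Mumford–Tate Lie algebra
`𝔪𝔱(H)` (`Motives/AtypicalHodgeLocus`: annihilator of the weight-`0` Hodge tensors of type `(0,0)`) and the Lie algebra of the
Hodge group `𝔥(H)` (`Motives/ZarhinHodgeGroupLieAlgebra`: annihilator of all Hodge tensors of all types `(p,p)`) as stabiliser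
Lie algebras, and proves `𝔥 ⊕ ℚ·id ≤ 𝔪𝔱` (`finrank_hodgeLie_add_one_le_mtRank`).  This file proves the reverse inclusion when
`H` is POLARIZABLE — the Lie-algebra form of `MT = 𝔾ₘ · Hg`, `Hg = MT ∩ Sp(Q)` (Deligne, LNM 900, I 3.4–3.6; Moonen–Zarhin 1999
§2: `MT = 𝔾ₘ · Hg`, so `dim MT = dim Hg + 1` in nonzero weight).

* §1 the **transpose along `θ = Q♭`**, `τ : T^{a,b} → T^{b,a}`, `(⊗vₖ) ⊗ (⊗φₗ) ↦ (⊗ θ⁻¹φₗ) ⊗ (⊗ θvₖ)` (written as an explicit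
  composite `comm ∘ (θ^{⊗a} ⊗ (θ⁻¹)^{⊗b})`, stated for any linear isomorphism `θ : V ≃ V^∨`): a left inverse
  (`transpose_retract`), intertwining of the derivation actions of every `X` with `θ X = −Xᵀ θ` (`transpose_tensorDerivation`),
  compatibility with complexification (`tensorSpaceToBaseChange_transpose`), and — for `θ = Q♭` and an `h`-orthonormal graded
  basis — `τ_ℂ E(β,γ) ∝ conj E(γ,β)` (`transposeC_hodgeTensorBasis`), so `τ` maps a Hodge tensor of type `(p,p)` into the span of
  the tensor-basis vectors of total degree `−p` (`tensorSpaceToBaseChange_transpose_mem_span_degree`).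
* §2 **`mem_hodgeLie_of_mem_mumfordTateLieAlgebra_of_skew`** — a `Q`-skew element of `𝔪𝔱(H)` lies in `𝔥(H)`.  PROOF: for a
  Hodge tensor `t` of type `(p,p)` in `T^{a,b}`, the concatenation `t · τt ∈ T^{a+b,b+a}` is a weight-`0` Hodge tensor of type
  `(0,0)` (`HodgeTensorConcatenation`), hence killed by `X ∈ 𝔪𝔱`; by the Leibniz rule and `τ`-equivariance
  `ρ(X)t · τt + t · τ(ρ(X)t) = 0`; undoing `τ` on the second factor, `u ⊗ t + t ⊗ u = 0` with `u = ρ(X)t`, so `u = 0`.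
* §3 **`mumfordTateLieAlgebra_eq_hodgeLie_sup`** — `𝔪𝔱(H) = 𝔥(H) ⊔ ℚ·id` for polarizable `H` of weight `n ≠ 0` (§2 and the
  Lie similitude `𝔪𝔱 ⊆ 𝔤𝔰𝔭(Q)`); **`mtRank_eq_finrank_hodgeLie_add_one`** — `dim_ℚ 𝔪𝔱(H) = dim_ℚ 𝔥(H) + 1` (`V ≠ 0`).

## References
* [Deligne1982HodgeCycles] P. Deligne, *Hodge cycles on abelian varieties*, LNM 900 (1982), I §3.1, Prop. 3.4, Prop. 3.6 (proof).
  [cite: Deligne1982HodgeCycles, I Prop. 3.4 and Prop. 3.6 (proof)]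
* [MoonenZarhin1999LowDim] B. Moonen, Yu. Zarhin, Math. Ann. 315 (1999), §2 («`MT(X) = 𝔾ₘ · Hg(X)`») [corpus: paper:arxiv-math_9901113 p. 3–4].
  [cite: MoonenZarhin1999LowDim, §2]
* [Huybrechts2016K3] D. Huybrechts, *Lectures on K3 Surfaces*, §3.3.4, Thm. 3.3.9. [cite: Huybrechts2016K3, Thm. 3.3.9]
-/

noncomputable section

open scoped TensorProduct PiTensorProduct

namespace Literature.AlgebraicGeometry.Motives

namespace HodgeStructure

universe u

variable {V : Type u} [AddCommGroup V] [Module ℚ V] [Module.Finite ℚ V] {n : ℤ} {H : HodgeStructure V n}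

/-! ### §1 The transpose along `θ : V ≃ V^∨` -/

section Transpose

omit [Module.Finite ℚ V] in
/-- **`τ` has a left inverse**: `(θ⁻¹^{⊗a} ⊗ θ^{⊗b})(comm (τ s)) = s` for `τ = comm ∘ (θ^{⊗a} ⊗ (θ⁻¹)^{⊗b})`.
[cite: Deligne1982HodgeCycles, I §3.1] -/
theorem transpose_retract (θ : V ≃ₗ[ℚ] Module.Dual ℚ V) (a b : ℕ) (s : hodgeTensorSpace V a b) :
    TensorProduct.map (PiTensorProduct.map fun _ : Fin a => (θ.symm : Module.Dual ℚ V →ₗ[ℚ] V))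
        (PiTensorProduct.map fun _ : Fin b => (θ : V →ₗ[ℚ] Module.Dual ℚ V))
      ((TensorProduct.comm ℚ (⨂[ℚ]^b V) (⨂[ℚ]^a (Module.Dual ℚ V)))
        ((TensorProduct.comm ℚ (⨂[ℚ]^a (Module.Dual ℚ V)) (⨂[ℚ]^b V))
          (TensorProduct.map (PiTensorProduct.map fun _ : Fin a => (θ : V →ₗ[ℚ] Module.Dual ℚ V))
            (PiTensorProduct.map fun _ : Fin b => (θ.symm : Module.Dual ℚ V →ₗ[ℚ] V)) s))) = s := by
  rw [← TensorProduct.comm_symm, LinearEquiv.symm_apply_apply, ← LinearMap.comp_apply, ← TensorProduct.map_comp,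
    ← PiTensorProduct.map_comp, ← PiTensorProduct.map_comp]
  have h1 : (fun _ : Fin a => (θ.symm : Module.Dual ℚ V →ₗ[ℚ] V) ∘ₗ (θ : V →ₗ[ℚ] Module.Dual ℚ V)) =
      fun _ => (LinearMap.id : V →ₗ[ℚ] V) := funext fun _ => LinearMap.ext θ.symm_apply_apply
  have h2 : (fun _ : Fin b => (θ : V →ₗ[ℚ] Module.Dual ℚ V) ∘ₗ (θ.symm : Module.Dual ℚ V →ₗ[ℚ] V)) =
      fun _ => (LinearMap.id : Module.Dual ℚ V →ₗ[ℚ] Module.Dual ℚ V) := funext fun _ => LinearMap.ext θ.apply_symm_apply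
  rw [h1, h2, PiTensorProduct.map_id, PiTensorProduct.map_id, TensorProduct.map_id, LinearMap.id_apply]

omit [Module.Finite ℚ V] in
/-- **`τ` intertwines the derivation actions of `X` when `θ X = −Xᵀ θ`** (e.g. `θ = Q♭` and `X` `Q`-skew):
`τ (ρ_{a,b}(X) s) = ρ_{b,a}(X) (τ s)` (naturality of the Leibniz action, `map_piTensorDerivation_of_comp_eq`, on both factors).
[cite: Deligne1982HodgeCycles, I §3.1] -/
theorem transpose_tensorDerivation (θ : V ≃ₗ[ℚ] Module.Dual ℚ V) {X : Module.End ℚ V}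
    (hθ : (θ : V →ₗ[ℚ] Module.Dual ℚ V) ∘ₗ X =
      (-(X.dualMap : Module.End ℚ (Module.Dual ℚ V))) ∘ₗ (θ : V →ₗ[ℚ] Module.Dual ℚ V))
    (a b : ℕ) (s : hodgeTensorSpace V a b) :
    (TensorProduct.comm ℚ (⨂[ℚ]^a (Module.Dual ℚ V)) (⨂[ℚ]^b V))
        (TensorProduct.map (PiTensorProduct.map fun _ : Fin a => (θ : V →ₗ[ℚ] Module.Dual ℚ V))
          (PiTensorProduct.map fun _ : Fin b => (θ.symm : Module.Dual ℚ V →ₗ[ℚ] V)) (tensorDerivation a b X s)) =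
      tensorDerivation b a X
        ((TensorProduct.comm ℚ (⨂[ℚ]^a (Module.Dual ℚ V)) (⨂[ℚ]^b V))
          (TensorProduct.map (PiTensorProduct.map fun _ : Fin a => (θ : V →ₗ[ℚ] Module.Dual ℚ V))
            (PiTensorProduct.map fun _ : Fin b => (θ.symm : Module.Dual ℚ V →ₗ[ℚ] V)) s)) := by
  -- the intertwining relation for `θ⁻¹`: `θ⁻¹ Xᵀ = -X θ⁻¹`
  have hθs : (θ.symm : Module.Dual ℚ V →ₗ[ℚ] V) ∘ₗ (X.dualMap : Module.End ℚ (Module.Dual ℚ V)) =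
      (-X) ∘ₗ (θ.symm : Module.Dual ℚ V →ₗ[ℚ] V) := by
    refine LinearMap.ext fun φ => ?_
    apply θ.injective
    have h := LinearMap.congr_fun hθ (θ.symm φ)
    simp only [LinearMap.comp_apply, LinearEquiv.coe_coe, LinearEquiv.apply_symm_apply, LinearMap.neg_apply] at h
    simp only [LinearMap.comp_apply, LinearEquiv.coe_coe, LinearEquiv.apply_symm_apply, LinearMap.neg_apply, map_neg, h,
      neg_neg]
  induction s using TensorProduct.induction_on with
  | zero => simp only [map_zero]
  | tmul x ξ =>
    rw [tensorDerivation_apply, tensorDerivation_apply, LinearMap.sub_apply, map_sub, map_sub, LinearMap.rTensor_tmul,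
      LinearMap.lTensor_tmul, TensorProduct.map_tmul, TensorProduct.map_tmul, TensorProduct.map_tmul, TensorProduct.comm_tmul,
      TensorProduct.comm_tmul, TensorProduct.comm_tmul, LinearMap.sub_apply, LinearMap.rTensor_tmul, LinearMap.lTensor_tmul,
      map_piTensorDerivation_of_comp_eq (θ : V →ₗ[ℚ] Module.Dual ℚ V) hθ,
      map_piTensorDerivation_of_comp_eq (θ.symm : Module.Dual ℚ V →ₗ[ℚ] V) hθs, map_neg, map_neg, LinearMap.neg_apply,
      LinearMap.neg_apply, TensorProduct.tmul_neg, TensorProduct.neg_tmul]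
    abel
  | add x y hx hy => rw [map_add, map_add, map_add, hx, hy, map_add, map_add, map_add]

/-- **`τ` commutes with complexification**: `ι (τ s) = τ_ℂ (ι s)` with `τ_ℂ = comm ∘ (θ_ℂ^{⊗a} ⊗ (θ_ℂ⁻¹)^{⊗b})`, `θ_ℂ = Q_ℂ♭`
(`θ_ℂ (1 ⊗ v) = (θ v)_ℂ`, `θ_ℂ⁻¹ (φ_ℂ) = 1 ⊗ θ⁻¹ φ`). [cite: Deligne1982HodgeCycles, I §3.1] -/
theorem Polarization.tensorSpaceToBaseChange_transpose (Q : Polarization H) (a b : ℕ) (s : hodgeTensorSpace V a b) :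
    tensorSpaceToBaseChange ℂ V b a
        ((TensorProduct.comm ℚ (⨂[ℚ]^a (Module.Dual ℚ V)) (⨂[ℚ]^b V))
          (TensorProduct.map (PiTensorProduct.map fun _ : Fin a => (Q.toDualEquiv : V →ₗ[ℚ] Module.Dual ℚ V))
            (PiTensorProduct.map fun _ : Fin b => (Q.toDualEquiv.symm : Module.Dual ℚ V →ₗ[ℚ] V)) s)) =
      (TensorProduct.comm ℂ (⨂[ℂ]^a (Module.Dual ℂ (ℂ ⊗[ℚ] V))) (⨂[ℂ]^b (ℂ ⊗[ℚ] V)))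
        (TensorProduct.map
          (PiTensorProduct.map fun _ : Fin a => (Q.toDualEquivC : ℂ ⊗[ℚ] V →ₗ[ℂ] Module.Dual ℂ (ℂ ⊗[ℚ] V)))
          (PiTensorProduct.map fun _ : Fin b => (Q.toDualEquivC.symm : Module.Dual ℂ (ℂ ⊗[ℚ] V) →ₗ[ℂ] ℂ ⊗[ℚ] V))
          (tensorSpaceToBaseChange ℂ V a b s)) := by
  suffices h : tensorSpaceToBaseChange ℂ V b a ∘ₗ
      ((TensorProduct.comm ℚ (⨂[ℚ]^a (Module.Dual ℚ V)) (⨂[ℚ]^b V)).toLinearMap ∘ₗ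
        TensorProduct.map (PiTensorProduct.map fun _ : Fin a => (Q.toDualEquiv : V →ₗ[ℚ] Module.Dual ℚ V))
          (PiTensorProduct.map fun _ : Fin b => (Q.toDualEquiv.symm : Module.Dual ℚ V →ₗ[ℚ] V))) =
      (((TensorProduct.comm ℂ (⨂[ℂ]^a (Module.Dual ℂ (ℂ ⊗[ℚ] V))) (⨂[ℂ]^b (ℂ ⊗[ℚ] V))).toLinearMap ∘ₗ
        TensorProduct.map
          (PiTensorProduct.map fun _ : Fin a => (Q.toDualEquivC : ℂ ⊗[ℚ] V →ₗ[ℂ] Module.Dual ℂ (ℂ ⊗[ℚ] V)))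
          (PiTensorProduct.map fun _ : Fin b =>
            (Q.toDualEquivC.symm : Module.Dual ℂ (ℂ ⊗[ℚ] V) →ₗ[ℂ] ℂ ⊗[ℚ] V))).restrictScalars ℚ) ∘ₗ
        tensorSpaceToBaseChange ℂ V a b from
    LinearMap.congr_fun h s
  ext v φ
  simp only [LinearMap.compMultilinearMap_apply, TensorProduct.AlgebraTensorModule.curry_apply, LinearMap.coe_restrictScalars,
    TensorProduct.curry_apply, LinearMap.coe_comp, LinearEquiv.coe_coe, Function.comp_apply, TensorProduct.map_tmul,
    PiTensorProduct.map_tprod, TensorProduct.comm_tmul, tensorSpaceToBaseChange_tprod_tmul_tprod, Q.toDualEquivC_one_tmul,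
    Q.toDualEquivC_symm_baseChange]

variable {S : Type u} [Fintype S] [DecidableEq S] {deg : S → ℤ}

omit [Module.Finite ℚ V] in
/-- A pure tensor with rescaled factors: `(⊗ₖ cₖ • vₖ) = (∏ cₖ) • ⊗ₖ vₖ`. [cite: Deligne1982HodgeCycles, I §3.1] -/
private theorem tprod_smul_eq {K : Type*} [Field K] {M : Type*} [AddCommGroup M] [Module K M] {m : ℕ} (c : Fin m → K)
    (v : Fin m → M) : PiTensorProduct.tprod K (fun k => c k • v k) = (∏ k, c k) • PiTensorProduct.tprod K v :=
  MultilinearMap.map_smul_univ _ c v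

/-- **`τ_ℂ E(β,γ) ∝ ι(conj E(γ,β))` in an `h`-orthonormal graded basis**: `θ_ℂ e_τ = h_τ⁻¹ ē^∨_τ`, `θ_ℂ⁻¹ e^∨_σ = (−1)ⁿ h_σ ē_σ`
(`toDualEquivC_basis`, `toDualEquivC_symm_dualBasis`), and `conj E(γ,β) = ι⁻¹((⊗ ē_{γₗ}) ⊗ (⊗ ē^∨_{βₖ}))` (`conj_hodgeTensorBasisBC`).
[cite: Deligne1982HodgeCycles, I §3.1 and Prop. 3.6 (proof)] -/
theorem Polarization.transposeC_hodgeTensorBasis (Q : Polarization H) (e : Module.Basis S ℂ (ℂ ⊗[ℚ] V))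
    (hon : ∀ σ τ, Q.form.baseChange ℂ (e σ) (conj (e τ)) = if σ = τ then (hodgeSign n (deg σ))⁻¹ else 0)
    {a b : ℕ} (β : Fin a → S) (γ : Fin b → S) :
    (TensorProduct.comm ℂ (⨂[ℂ]^a (Module.Dual ℂ (ℂ ⊗[ℚ] V))) (⨂[ℂ]^b (ℂ ⊗[ℚ] V)))
        (TensorProduct.map
          (PiTensorProduct.map fun _ : Fin a => (Q.toDualEquivC : ℂ ⊗[ℚ] V →ₗ[ℂ] Module.Dual ℂ (ℂ ⊗[ℚ] V)))
          (PiTensorProduct.map fun _ : Fin b => (Q.toDualEquivC.symm : Module.Dual ℂ (ℂ ⊗[ℚ] V) →ₗ[ℂ] ℂ ⊗[ℚ] V))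
          (hodgeTensorBasis e a b (β, γ))) =
      ((∏ l, ((((n.negOnePow : ℤˣ) : ℤ) : ℂ) * hodgeSign n (deg (γ l)))) * ∏ k, (hodgeSign n (deg (β k)))⁻¹) •
        hodgeTensorSpaceBaseChange V b a (conj (hodgeTensorBasisBC e b a (γ, β))) := by
  rw [conj_hodgeTensorBasisBC, LinearEquiv.apply_symm_apply, hodgeTensorBasis_apply, TensorProduct.map_tmul,
    PiTensorProduct.map_tprod, PiTensorProduct.map_tprod, TensorProduct.comm_tmul]
  simp only [LinearEquiv.coe_coe, Q.toDualEquivC_basis e hon, Q.toDualEquivC_symm_dualBasis e hon]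
  rw [tprod_smul_eq, tprod_smul_eq, TensorProduct.smul_tmul, TensorProduct.tmul_smul, TensorProduct.tmul_smul, smul_smul,
    mul_comm]

variable [HodgeTensorFacts.{u, u}]

/-- **`τ` maps a Hodge tensor of type `(p,p)` into the span of the tensor-basis vectors of `T^{b,a}` of total degree `−p`**:
for `t ∈ T^{a,b}` rational with `1 ⊗ t ∈ Hdg^p`, `(a−b)n = 2p`, and an `h`-orthonormal graded basis `e`,
`ι(τ t) ∈ span {E_{b,a}(y) | tensorDegree y = −p}` — `ι t` has total degree `p`, `τ_ℂ E(β,γ) ∝ ι(conj E(γ,β))`, `E(γ,β)` lies in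
the Hodge piece of `T^{b,a}` of degree `−D(β,γ)` and conjugation swaps the pieces (`conj_mem_piece`, `tensorSpace_piece_eq_span`).
[cite: Deligne1982HodgeCycles, I Prop. 3.6 (proof)] [cite: DeligneHodgeII1971, 1.1.12 and 1.2.5] -/
theorem Polarization.tensorSpaceToBaseChange_transpose_mem_span_degree (Q : Polarization H) (e : Module.Basis S ℂ (ℂ ⊗[ℚ] V))
    (hF : ∀ q, H.F q = Submodule.span ℂ (e '' {σ | q ≤ deg σ}))
    (hFc : ∀ q, complexConj (H.F q) = Submodule.span ℂ (e '' {σ | deg σ ≤ n - q}))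
    (hon : ∀ σ τ, Q.form.baseChange ℂ (e σ) (conj (e τ)) = if σ = τ then (hodgeSign n (deg σ))⁻¹ else 0)
    {a b : ℕ} {p : ℤ} (hab : ((a : ℤ) - b) * n = 2 * p) {t : hodgeTensorSpace V a b} (ht : t ∈ (H.tensorSpace a b).hodgeClasses p) :
    tensorSpaceToBaseChange ℂ V b a
        ((TensorProduct.comm ℚ (⨂[ℚ]^a (Module.Dual ℚ V)) (⨂[ℚ]^b V))
          (TensorProduct.map (PiTensorProduct.map fun _ : Fin a => (Q.toDualEquiv : V →ₗ[ℚ] Module.Dual ℚ V))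
            (PiTensorProduct.map fun _ : Fin b => (Q.toDualEquiv.symm : Module.Dual ℚ V →ₗ[ℚ] V)) t)) ∈
      Submodule.span ℂ (hodgeTensorBasis e b a '' {y | tensorDegree deg y = -p}) := by
  rw [Q.tensorSpaceToBaseChange_transpose]
  have hι := tensorSpaceToBaseChange_mem_span_degree_eq H e hF hFc hab ht
  -- `τ_ℂ` maps the degree-`p` span of `T^{a,b}` into the degree-`(-p)` span of `T^{b,a}`: check on basis tensors
  set τC : hodgeTensorSpaceOver ℂ (ℂ ⊗[ℚ] V) a b →ₗ[ℂ] hodgeTensorSpaceOver ℂ (ℂ ⊗[ℚ] V) b a :=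
    (TensorProduct.comm ℂ (⨂[ℂ]^a (Module.Dual ℂ (ℂ ⊗[ℚ] V))) (⨂[ℂ]^b (ℂ ⊗[ℚ] V))).toLinearMap ∘ₗ
      TensorProduct.map
        (PiTensorProduct.map fun _ : Fin a => (Q.toDualEquivC : ℂ ⊗[ℚ] V →ₗ[ℂ] Module.Dual ℂ (ℂ ⊗[ℚ] V)))
        (PiTensorProduct.map fun _ : Fin b => (Q.toDualEquivC.symm : Module.Dual ℂ (ℂ ⊗[ℚ] V) →ₗ[ℂ] ℂ ⊗[ℚ] V)) with hτC
  change τC (tensorSpaceToBaseChange ℂ V a b t) ∈ _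
  have hgen : ∀ x ∈ {x : (Fin a → S) × (Fin b → S) | tensorDegree deg x = p},
      τC (hodgeTensorBasis e a b x) ∈ Submodule.span ℂ (hodgeTensorBasis e b a '' {y | tensorDegree deg y = -p}) := by
    rintro ⟨β, γ⟩ hx
    simp only [Set.mem_setOf_eq] at hx
    have hτ : τC (hodgeTensorBasis e a b (β, γ)) = _ := Q.transposeC_hodgeTensorBasis e hon β γ
    rw [hτ]
    refine Submodule.smul_mem _ _ ?_
    -- `E(γ,β)` is in the Hodge piece of `T^{b,a}` of degree `-p`... rather `D(γ,β) = -p`; conjugation sends it to degree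
    -- `(b - a) n - (-p) = -p` as well?  No: `D_{b,a}(γ,β) = -D_{a,b}(β,γ) = -p`, the piece `((b-a)n - (-p), -p)` after `conj`.
    have hD : tensorDegree deg ((γ, β) : (Fin b → S) × (Fin a → S)) = -p := by
      simp only [tensorDegree_apply] at hx ⊢
      linarith
    have hPQ : (-p) + (p - ((a : ℤ) - b) * n + 2 * p - 2 * p) = ((b : ℤ) - a) * n := by ring
    have hmem : hodgeTensorBasisBC e b a (γ, β) ∈ (H.tensorSpace b a).piece (-p) (((b : ℤ) - a) * n - (-p)) := by
      rw [tensorSpace_piece_eq_span H e hF hFc b a (show (-p) + (((b : ℤ) - a) * n - (-p)) = ((b : ℤ) - a) * n by ring)]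
      exact Submodule.subset_span ⟨(γ, β), hD, rfl⟩
    have hconj := conj_mem_piece _ hmem
    rw [tensorSpace_piece_eq_span H e hF hFc b a (show (((b : ℤ) - a) * n - (-p)) + (-p) = ((b : ℤ) - a) * n by ring)] at hconj
    -- transport along `hodgeTensorSpaceBaseChange`
    have himg := Submodule.mem_map_of_mem (f := (hodgeTensorSpaceBaseChange V b a).toLinearMap) hconj
    rw [Submodule.map_span, ← Set.image_comp] at himg
    have hdeg : ((b : ℤ) - a) * n - (-p) = -p := by linarith
    rw [hdeg] at himg
    refine Submodule.span_mono ?_ himg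
    rintro _ ⟨y, hy, rfl⟩
    exact ⟨y, hy, (hodgeTensorSpaceBaseChange_hodgeTensorBasisBC e b a y).symm⟩
  -- extend linearly
  refine Submodule.span_induction (p := fun w _ => τC w ∈ Submodule.span ℂ (hodgeTensorBasis e b a '' {y | tensorDegree deg y = -p}))
    (fun u hu => ?_) ?_ (fun u₁ u₂ _ _ h₁ h₂ => ?_) (fun c u _ hu => ?_) hι
  · obtain ⟨x, hx, rfl⟩ := hu
    exact hgen x hx
  · rw [map_zero]; exact Submodule.zero_mem _
  · rw [map_add]; exact Submodule.add_mem _ h₁ h₂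
  · rw [map_smul]; exact Submodule.smul_mem _ c hu

end Transpose

/-! ### §2 A `Q`-skew element of `𝔪𝔱(H)` lies in `𝔥(H)` -/

section Skew

variable [HodgeTensorFacts.{u, u}]

/-- **`𝔪𝔱(H) ∩ 𝔰𝔭(Q) ⊆ 𝔥(H)`**: an element of the Mumford–Tate Lie algebra that is skew for a polarization `Q` kills every
Hodge tensor of every type `(p,p)`.  For such a tensor `t ∈ T^{a,b}` the concatenation `t · τt ∈ T^{a+b,b+a}` is a weight-`0`
Hodge tensor of type `(0,0)` (`tensorSpaceMulEquiv_mem_span_degree`, `mem_hodgeClasses_of_mem_span_degree_zero`), so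
`ρ(X)(t · τt) = 0`; the Leibniz rule (`tensorDerivation_tensorSpaceMulEquiv`) and `τ ρ(X) = ρ(X) τ` (`X` skew) give
`ρ(X)t ⊗ τt + t ⊗ τ(ρ(X)t) = 0`, hence `ρ(X)t ⊗ t + t ⊗ ρ(X)t = 0` and `ρ(X)t = 0` (`eq_zero_of_tmul_add_tmul_eq_zero`).  This is
the Lie-algebra form of `Hg = MT ∩ Sp(Q)`. [cite: Deligne1982HodgeCycles, I Prop. 3.4 and Prop. 3.6 (proof)]
[cite: MoonenZarhin1999LowDim, §2] -/
theorem mem_hodgeLie_of_mem_mumfordTateLieAlgebra_of_skew (Q : Polarization H) {X : Module.End ℚ V}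
    (hX : X ∈ H.mumfordTateLieAlgebra) (hskew : ∀ v w, Q.form (X v) w + Q.form v (X w) = 0) : X ∈ H.hodgeLie := by
  classical
  rw [mem_hodgeLie_iff]
  intro a b p hab t ht
  by_cases ht0 : t = 0
  · rw [ht0, map_zero]
  obtain ⟨S, _, _, deg, e, hF, hFc, -, hon⟩ := Q.exists_orthonormal_graded_basis
  -- notation-free names for `θ`, `τ t`
  set θ : V ≃ₗ[ℚ] Module.Dual ℚ V := Q.toDualEquiv with hθdef
  set τt : hodgeTensorSpace V b a :=
    (TensorProduct.comm ℚ (⨂[ℚ]^a (Module.Dual ℚ V)) (⨂[ℚ]^b V))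
      (TensorProduct.map (PiTensorProduct.map fun _ : Fin a => (θ : V →ₗ[ℚ] Module.Dual ℚ V))
        (PiTensorProduct.map fun _ : Fin b => (θ.symm : Module.Dual ℚ V →ₗ[ℚ] V)) t) with hτt
  set u := tensorDerivation a b X t with hu
  -- (1) `t · τt` is a weight-0 Hodge tensor of type (0,0)
  have hprod : tensorSpaceMulEquiv a b b a (t ⊗ₜ[ℚ] τt) ∈ (H.tensorSpace (a + b) (b + a)).hodgeClasses 0 := by
    apply mem_hodgeClasses_of_mem_span_degree_zero H e hF
    rw [← tensorSpaceMulEquiv_tensorSpaceToBaseChange]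
    have h := tensorSpaceMulEquiv_mem_span_degree e deg (tensorSpaceToBaseChange_mem_span_degree_eq H e hF hFc hab ht)
      (Q.tensorSpaceToBaseChange_transpose_mem_span_degree e hF hFc hon hab ht)
    rwa [add_neg_cancel] at h
  -- (2) `X` kills it
  have hkill : tensorDerivation (a + b) (b + a) X (tensorSpaceMulEquiv a b b a (t ⊗ₜ[ℚ] τt)) = 0 := by
    rw [← tensorSpaceDeriv_eq_tensorDerivation]
    exact (H.mem_mumfordTateLieAlgebra_iff X).1 hX (a + b) (b + a) (by push_cast; ring) _ hprod
  -- (3) Leibniz and `τ`-equivariance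
  have hθX : (θ : V →ₗ[ℚ] Module.Dual ℚ V) ∘ₗ X =
      (-(X.dualMap : Module.End ℚ (Module.Dual ℚ V))) ∘ₗ (θ : V →ₗ[ℚ] Module.Dual ℚ V) := by
    refine LinearMap.ext fun v => LinearMap.ext fun w => ?_
    simp only [LinearMap.comp_apply, LinearEquiv.coe_coe, hθdef, Polarization.toDualEquiv_apply, LinearMap.neg_apply,
      LinearMap.dualMap_apply]
    linarith [hskew v w]
  have hτu : (TensorProduct.comm ℚ (⨂[ℚ]^a (Module.Dual ℚ V)) (⨂[ℚ]^b V))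
      (TensorProduct.map (PiTensorProduct.map fun _ : Fin a => (θ : V →ₗ[ℚ] Module.Dual ℚ V))
        (PiTensorProduct.map fun _ : Fin b => (θ.symm : Module.Dual ℚ V →ₗ[ℚ] V)) u) = tensorDerivation b a X τt :=
    transpose_tensorDerivation θ hθX a b t
  rw [tensorDerivation_tensorSpaceMulEquiv, ← hτu, ← map_add, LinearEquiv.map_eq_zero_iff] at hkill
  -- (4) undo `τ` on the second factor: `u ⊗ t + t ⊗ u = 0`
  have hστ := transpose_retract θ a b
  have h2 := congrArg (TensorProduct.map (LinearMap.id : hodgeTensorSpace V a b →ₗ[ℚ] hodgeTensorSpace V a b)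
    (TensorProduct.map (PiTensorProduct.map fun _ : Fin a => (θ.symm : Module.Dual ℚ V →ₗ[ℚ] V))
        (PiTensorProduct.map fun _ : Fin b => (θ : V →ₗ[ℚ] Module.Dual ℚ V)) ∘ₗ
      (TensorProduct.comm ℚ (⨂[ℚ]^b V) (⨂[ℚ]^a (Module.Dual ℚ V))).toLinearMap)) hkill
  rw [map_add, TensorProduct.map_tmul, TensorProduct.map_tmul, map_zero, LinearMap.id_apply, LinearMap.id_apply,
    LinearMap.comp_apply, LinearMap.comp_apply, LinearEquiv.coe_coe, hτt, hστ, hστ] at h2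
  exact eq_zero_of_tmul_add_tmul_eq_zero ht0 h2

end Skew

/-! ### §3 `𝔪𝔱 = 𝔥 ⊔ ℚ·id` and `dim MT = dim Hg + 1` -/

section Rank

variable [HodgeTensorFacts.{u, u}]

/-- **`𝔪𝔱(H) = 𝔥(H) ⊔ ℚ·id` for a polarizable Hodge structure of nonzero weight** (Lie-algebra form of `MT = 𝔾ₘ · Hg`): `⊇` is
the tree's `hodgeLie_le_mumfordTateLieAlgebra` and `id_mem_mumfordTateLieAlgebra`; `⊆`: `X ∈ 𝔪𝔱` is `c·id` plus a `Q`-skew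
element of `𝔪𝔱` (`Polarization.exists_sub_smul_id_skew_of_mem_mumfordTateLieAlgebra`), which lies in `𝔥` (§2).
[cite: MoonenZarhin1999LowDim, §2] [cite: Deligne1982HodgeCycles, I Prop. 3.4 and Prop. 3.6 (proof)] -/
theorem mumfordTateLieAlgebra_eq_hodgeLie_sup (H : HodgeStructure V n) (Q : Polarization H) (hn : n ≠ 0) :
    H.mumfordTateLieAlgebra = H.hodgeLie ⊔ ℚ ∙ (LinearMap.id : Module.End ℚ V) := by
  refine le_antisymm (fun X hX => ?_) (sup_le (hodgeLie_le_mumfordTateLieAlgebra H)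
    ((Submodule.span_singleton_le_iff_mem _ _).2 (id_mem_mumfordTateLieAlgebra H hn)))
  obtain ⟨c, hXc, hskew⟩ := Q.exists_sub_smul_id_skew_of_mem_mumfordTateLieAlgebra hn hX
  have hmem : X - c • (LinearMap.id : Module.End ℚ V) ∈ H.hodgeLie :=
    mem_hodgeLie_of_mem_mumfordTateLieAlgebra_of_skew Q hXc hskew
  have hX' : X = (X - c • LinearMap.id) + c • LinearMap.id := by abel
  rw [hX']
  exact Submodule.add_mem_sup hmem (Submodule.smul_mem _ c (Submodule.mem_span_singleton_self _))

/-- **`dim_ℚ MT(H) = dim_ℚ Hg(H) + 1`** for a polarizable Hodge structure of nonzero weight on `V ≠ 0`: `𝔪𝔱 = 𝔥 ⊕ ℚ·id`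
(`id ∉ 𝔥` as `𝔥 ⊆ 𝔰𝔭(Q)`, `finrank_hodgeLie_add_one_le_mtRank`). [cite: MoonenZarhin1999LowDim, §2]
[cite: Deligne1982HodgeCycles, I Prop. 3.4] -/
theorem mtRank_eq_finrank_hodgeLie_add_one [Nontrivial V] (H : HodgeStructure V n) (Q : Polarization H) (hn : n ≠ 0) :
    H.mtRank = Module.finrank ℚ H.hodgeLie + 1 := by
  refine le_antisymm ?_ (finrank_hodgeLie_add_one_le_mtRank H Q hn)
  rw [mtRank, mumfordTateLieAlgebra_eq_hodgeLie_sup H Q hn]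
  calc Module.finrank ℚ ↥(H.hodgeLie ⊔ ℚ ∙ (LinearMap.id : Module.End ℚ V))
      ≤ Module.finrank ℚ H.hodgeLie + Module.finrank ℚ (ℚ ∙ (LinearMap.id : Module.End ℚ V)) :=
        Submodule.finrank_add_le_finrank_add_finrank _ _
    _ ≤ Module.finrank ℚ H.hodgeLie + 1 := by
        have hid0 : (LinearMap.id : Module.End ℚ V) ≠ 0 := one_ne_zero
        rw [finrank_span_singleton hid0]

/-- The same for any polarizable `H` (`IsPolarizable`). [cite: MoonenZarhin1999LowDim, §2] -/
theorem mtRank_eq_finrank_hodgeLie_add_one_of_isPolarizable [Nontrivial V] (H : HodgeStructure V n) (hH : H.IsPolarizable)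
    (hn : n ≠ 0) : H.mtRank = Module.finrank ℚ H.hodgeLie + 1 := by
  obtain ⟨Q⟩ := hH
  exact mtRank_eq_finrank_hodgeLie_add_one H Q hn

end Rank

end HodgeStructure

end Literature.AlgebraicGeometry.Motives

end
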